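import Literature.Probability.RandomPlanarGeometry.SAWTriangularPolygonUnrooting
import Literature.Analysis.Asymptotics.SupermultiplicativeDoubling
import HarnessLib

/-!
# Madras' doubling bootstrap for triangular-lattice polygons: a `√N`-gain join inequality `c√N·q_N(𝕋)² ≤ q_{2N+K}(𝕋)`
# implies `q_N(𝕋) ≤ A · N^{−1/2} · μ(𝕋)^N` (stub S6 of the line «TRI-MADRAS», unconditional as an implication)

Topic `Literature/Probability/RandomPlanarGeometry` (lane «pcv-sawmu», a-p4 g9; on top of `SAWTriangularPolygonUnrooting.lean` (p362688:
`triLoopCount N = 2N · triPolygonNumber N`, `triPolygonNumber_le_succ`), `SAWTriangularPolygonSupermult.lean` (p361897: `triPolygonNumber`),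
`SAWTriangularPolygonGrowth.lean` (`abs_log_triLoopCount_sub_le`, `tendsto_log_triLoopCount_div`) and the model-free doubling lemma
`Literature.Analysis.Asymptotics.Madras1995_doubling_polynomial` (`(N^θ a_N)² ≤ (2N)^θ a_{2N}`, `a_n^{1/n} → λ` ⟹ `a_N ≤ N^{−θ} λ^N`)).

Source: N. Madras, *A rigorous bound on the critical exponent for the number of lattice trees, animals, and polygons*, J. Stat. Phys. 78
(1995) 681–699, §2 (on `ℤ²`: the join inequality with a `√n` gain and the a-priori bound from the "superadditivity-type inequality";
analytic half printed again in N. Madras, J. Phys. Conf. Ser. 42 (2006) §3 (3.5)–(3.7)); tree `ℤ²` edition: `SAWPolygonDoublingBootstrap.lean`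
(`SAW.bootstrap2 : JoinIneq2 → PolygonLimit → MAD95_Explicit2`) and `SAWPolygonMadrasBound.lean`.  Here: the triangular lattice, with
`q_N(𝕋) = triPolygonNumber N`, for an ARBITRARY join inequality `c √N q_N² ≤ q_{2N+K}` (`N ≥ N₀`) — the combinatorial stubs S2–S5 of the
lane's design note `DESIGN-hex-madras-sqrtN.md` are what would supply it; this file is their analytic consumer, proved now.

## What is proved (namespace `…SAW`; all `theorem`s, axioms standard)

* `triPolygonNumber_pos (hN : 4 ≤ N) : 0 < triPolygonNumber N`; `tendsto_log_triPolygonNumber_div : log q_N(𝕋) / N → log μ(𝕋)`;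
* **`triPolygonNumber_le_rpow_of_joinIneq (hc : 0 < c) (hJ : ∀ N ≥ N₀, c·√N·q_N² ≤ q_{2N+K}) :
  ∃ A, ∀ N ≥ 1, (q_N : ℝ) ≤ A · N^{−1/2} · μ(𝕋)^N`** (Madras' bootstrap on `𝕋`).

Printed anchors (label lit-2 g16, 2026-08-23: CONSOLIDATION-BY-TRANSFER, analytic half, implication form — no new fact):
[cite: Madras1995LatticeAnimalsExponent, §2 (primary, not held: θ ≥ 1/2 on ℤ² by polygon joining)] [cite: Hammond2015SAPJoining, §2
(arXiv v5 p. 4: "he has shown in [26] using a polygon joining technique that θ_n ≥ 1/2 − o(1) for d = 2"; §4.1 Definition 4.3 p. 20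
(Madras join), Definition 4.8 / Lemma 4.9 pp. 24–25)].
-/

noncomputable section

open Filter Topology Finset Literature.Probability.LatticeModels Literature.Analysis.Asymptotics

namespace Literature.Probability.RandomPlanarGeometry.SAW

/-! ### Positivity and the logarithmic growth rate of `q_N(𝕋)` -/

/-- `q_N(𝕋) > 0` for `N ≥ 4` (via `2N q_N = triLoopCount N > 0`). [cite: MadrasSlade1993, §3.2 eq. (3.2.1) p. 63] -/
theorem triPolygonNumber_pos {N : ℕ} (hN : 4 ≤ N) : 0 < triPolygonNumber N := by
  have h := triLoopCount_eq_mul_triPolygonNumber (N := N) (by omega)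
  have hpos : (0 : ℝ) < (triLoopCount N : ℝ) := (abs_log_triLoopCount_sub_le hN).1
  have hpos' : 0 < triLoopCount N := by exact_mod_cast hpos
  rw [h] at hpos'
  by_contra h0
  push Not at h0
  have hz : triPolygonNumber N = 0 := by omega
  rw [hz, mul_zero] at hpos'
  exact lt_irrefl _ hpos'

/-- `log (2N) / N → 0`. [folklore] -/
private theorem tendsto_log_two_mul_div' : Tendsto (fun N : ℕ => Real.log (2 * N) / N) atTop (𝓝 0) := by
  have h1 : Tendsto (fun x : ℝ => Real.log x ^ 1 / (1 * x + 0)) atTop (𝓝 0) :=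
    Real.tendsto_pow_log_div_mul_add_atTop 1 0 1 one_ne_zero
  have h2 : Tendsto (fun N : ℕ => Real.log N / N) atTop (𝓝 0) := by
    have := h1.comp tendsto_natCast_atTop_atTop
    refine this.congr' (Eventually.of_forall fun N => ?_)
    simp [Function.comp]
  have h3 : Tendsto (fun N : ℕ => Real.log 2 / N) atTop (𝓝 0) :=
    tendsto_const_nhds.div_atTop tendsto_natCast_atTop_atTop
  have h4 := h3.add h2
  rw [add_zero] at h4
  refine h4.congr' ?_
  filter_upwards [eventually_ge_atTop 1] with N hN
  have hN0 : (0 : ℝ) < N := by exact_mod_cast (by omega : 0 < N)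
  rw [Real.log_mul two_ne_zero hN0.ne', add_div]

/-- `log q_N(𝕋) = log triLoopCount N − log (2N)` for `N ≥ 4`. [cite: MadrasSlade1993, §3.2 eq. (3.2.1) p. 63] -/
theorem log_triPolygonNumber_eq {N : ℕ} (hN : 4 ≤ N) :
    Real.log (triPolygonNumber N) = Real.log (triLoopCount N) - Real.log (2 * N) := by
  have h := triLoopCount_eq_mul_triPolygonNumber (N := N) (by omega)
  have hq : (0 : ℝ) < triPolygonNumber N := by exact_mod_cast triPolygonNumber_pos hN
  have hN0 : (0 : ℝ) < N := by exact_mod_cast (by omega : 0 < N)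
  have hR : (triLoopCount N : ℝ) = 2 * N * triPolygonNumber N := by exact_mod_cast h
  rw [hR, Real.log_mul (by positivity) hq.ne']
  ring

/-- **`log q_N(𝕋) / N → log μ(𝕋)`** (Hammersley's limit in the printed normalisation, logarithmic form).
[cite: MadrasSlade1993, §3.2 Cor. 3.2.5 (3.2.9) p. 67 and eq. (3.2.1) p. 63] -/
theorem tendsto_log_triPolygonNumber_div :
    Tendsto (fun N : ℕ => Real.log (triPolygonNumber N) / N) atTop (𝓝 logMuTri) := by
  have h := tendsto_log_triLoopCount_div.sub tendsto_log_two_mul_div'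
  rw [sub_zero] at h
  refine h.congr' ?_
  filter_upwards [eventually_ge_atTop 4] with N hN
  rw [log_triPolygonNumber_eq hN, sub_div]

/-! ### The bootstrap -/

/-- `μ(𝕋) ≥ 1`. [cite: MadrasSlade1993, §1.2 (μ ≥ 1)] -/
private theorem one_le_muTri : (1 : ℝ) ≤ Real.exp logMuTri := Real.one_le_exp logMuTri_pos.le

/-- **Madras' doubling bootstrap on the triangular lattice.**  If for some `c > 0`, `K`, `N₀` the polygon numbers up to translation satisfy
the join inequality with a `√N` gain, `c · √N · q_N(𝕋)² ≤ q_{2N+K}(𝕋)` for all `N ≥ N₀`, then `q_N(𝕋) ≤ A · N^{−1/2} · μ(𝕋)^N` for every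
`N ≥ 1`, for some constant `A`.
[cite: Madras1995LatticeAnimalsExponent, §2 (primary, not held: θ ≥ 1/2 on ℤ² by polygon joining; the a-priori bound from the
superadditivity-type inequality)] [cite: Hammond2015SAPJoining, §2 (arXiv v5 p. 4: "he has shown in [26] using a polygon joining technique
that θ_n ≥ 1/2 − o(1) for d = 2")] — 𝕋 edition of the analytic half — CONSOLIDATION-BY-TRANSFER (lit-2 g16, 2026-08-23). -/
theorem triPolygonNumber_le_rpow_of_joinIneq {c : ℝ} {K N₀ : ℕ} (hc : 0 < c)
    (hJ : ∀ N : ℕ, N₀ ≤ N → c * Real.sqrt N * (triPolygonNumber N : ℝ) ^ 2 ≤ triPolygonNumber (2 * N + K)) :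
    ∃ A : ℝ, ∀ N : ℕ, 1 ≤ N → (triPolygonNumber N : ℝ) ≤ A * (N : ℝ) ^ (-(1 / 2 : ℝ)) * Real.exp logMuTri ^ N := by
  set μ : ℝ := Real.exp logMuTri with hμ
  have hμ1 : 1 ≤ μ := one_le_muTri
  have hμ0 : 0 < μ := by positivity
  set q : ℕ → ℝ := fun N => (triPolygonNumber N : ℝ) with hqdef
  have hq0 : ∀ N, 0 ≤ q N := fun N => Nat.cast_nonneg _
  -- the threshold
  set M₁ : ℕ := N₀ + 2 * K + 4 with hM₁
  -- the auxiliary sequence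
  set a : ℕ → ℝ := fun M => if M₁ ≤ M then c * q (M - K) else 0 with hadef
  have ha0 : ∀ n, 1 ≤ n → 0 ≤ a n := fun n _ => by
    simp only [hadef]; split_ifs
    · exact mul_nonneg hc.le (hq0 _)
    · exact le_rfl
  have ha_of_ge : ∀ M, M₁ ≤ M → a M = c * q (M - K) := fun M hM => by simp only [hadef]; rw [if_pos hM]
  -- (hsq): `(√M a_M)² ≤ √(2M) a_{2M}`
  have hsq : ∀ M : ℕ, 1 ≤ M → (((M : ℝ) ^ (1 / 2 : ℝ)) * a M) ^ 2 ≤ ((2 * M : ℕ) : ℝ) ^ (1 / 2 : ℝ) * a (2 * M) := by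
    intro M hM1
    by_cases hM : M₁ ≤ M
    · have h2M : M₁ ≤ 2 * M := by omega
      rw [ha_of_ge M hM, ha_of_ge (2 * M) h2M, ← Real.sqrt_eq_rpow, ← Real.sqrt_eq_rpow]
      have hMK : N₀ ≤ M - K := by omega
      have hJ' := hJ (M - K) hMK
      rw [show 2 * (M - K) + K = 2 * M - K by omega] at hJ'
      have hMKpos : (0 : ℝ) < ((M - K : ℕ) : ℝ) := by exact_mod_cast (show 0 < M - K by omega)
      have hsqrtMK : 0 < Real.sqrt ((M - K : ℕ) : ℝ) := Real.sqrt_pos.2 hMKpos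
      -- `q_{M−K}² ≤ q_{2M−K} / (c √(M−K))`
      have hq2 : q (M - K) ^ 2 ≤ q (2 * M - K) / (c * Real.sqrt ((M - K : ℕ) : ℝ)) := by
        rw [le_div_iff₀ (by positivity)]
        calc q (M - K) ^ 2 * (c * Real.sqrt ((M - K : ℕ) : ℝ)) = c * Real.sqrt ((M - K : ℕ) : ℝ) * q (M - K) ^ 2 := by ring
          _ ≤ q (2 * M - K) := hJ'
      -- `M ≤ √(2M) √(M−K)` since `M ≤ 2(M−K)`
      have hgeo : (M : ℝ) ≤ Real.sqrt ((2 * M : ℕ) : ℝ) * Real.sqrt ((M - K : ℕ) : ℝ) := by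
        rw [← Real.sqrt_mul (by positivity)]
        apply Real.le_sqrt_of_sq_le
        have h1 : ((M : ℕ) : ℝ) ≤ 2 * ((M - K : ℕ) : ℝ) := by
          have : M ≤ 2 * (M - K) := by omega
          exact_mod_cast this
        have hM0 : (0 : ℝ) ≤ M := Nat.cast_nonneg _
        calc ((M : ℝ)) ^ 2 = (M : ℝ) * M := sq _
          _ ≤ (M : ℝ) * (2 * ((M - K : ℕ) : ℝ)) := mul_le_mul_of_nonneg_left h1 hM0
          _ = ((2 * M : ℕ) : ℝ) * ((M - K : ℕ) : ℝ) := by push_cast; ring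
      calc (Real.sqrt (M : ℝ) * (c * q (M - K))) ^ 2 = (M : ℝ) * c ^ 2 * q (M - K) ^ 2 := by
            rw [mul_pow, Real.sq_sqrt (Nat.cast_nonneg _)]; ring
        _ ≤ (M : ℝ) * c ^ 2 * (q (2 * M - K) / (c * Real.sqrt ((M - K : ℕ) : ℝ))) :=
            mul_le_mul_of_nonneg_left hq2 (by positivity)
        _ = (M : ℝ) / Real.sqrt ((M - K : ℕ) : ℝ) * (c * q (2 * M - K)) := by
            field_simp
        _ ≤ Real.sqrt ((2 * M : ℕ) : ℝ) * (c * q (2 * M - K)) := by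
            apply mul_le_mul_of_nonneg_right _ (mul_nonneg hc.le (hq0 _))
            rw [div_le_iff₀ hsqrtMK]; exact hgeo
    · -- below the threshold `a_M = 0`
      have : a M = 0 := by simp only [hadef]; rw [if_neg hM]
      rw [this, mul_zero, zero_pow two_ne_zero]
      exact mul_nonneg (Real.rpow_nonneg (Nat.cast_nonneg _) _) (ha0 _ (by omega))
  -- (hlim): `a_n^{1/n} → μ`
  have hKlim : Tendsto (fun n : ℕ => n - K) atTop atTop := tendsto_sub_atTop_nat K
  have hlog : Tendsto (fun n : ℕ => Real.log (a n) / n) atTop (𝓝 logMuTri) := by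
    -- `log a_n / n = log c / n + (log q_{n−K} / (n−K)) · ((n−K)/n)`
    have h1 : Tendsto (fun n : ℕ => Real.log c / n) atTop (𝓝 0) :=
      tendsto_const_nhds.div_atTop tendsto_natCast_atTop_atTop
    have h2 : Tendsto (fun n : ℕ => Real.log (q (n - K)) / ((n - K : ℕ) : ℝ)) atTop (𝓝 logMuTri) :=
      tendsto_log_triPolygonNumber_div.comp hKlim
    have h3 : Tendsto (fun n : ℕ => (((n - K : ℕ) : ℝ)) / n) atTop (𝓝 1) := by
      have h31 : Tendsto (fun n : ℕ => (1 : ℝ) - (K : ℝ) / n) atTop (𝓝 (1 - 0)) :=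
        tendsto_const_nhds.sub (tendsto_const_nhds.div_atTop tendsto_natCast_atTop_atTop)
      rw [sub_zero] at h31
      refine h31.congr' ?_
      filter_upwards [eventually_ge_atTop (K + 1)] with n hn
      have hn0 : (n : ℝ) ≠ 0 := by exact_mod_cast (show n ≠ 0 by omega)
      rw [Nat.cast_sub (by omega)]
      field_simp
    have h4 := h1.add (h2.mul h3)
    rw [zero_add, mul_one] at h4
    refine h4.congr' ?_
    filter_upwards [eventually_ge_atTop (M₁ + 1)] with n hn
    have hnK : 4 ≤ n - K := by omega
    have hqpos : 0 < q (n - K) := by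
      show (0 : ℝ) < (triPolygonNumber (n - K) : ℝ); exact_mod_cast triPolygonNumber_pos hnK
    have hn0 : (n : ℝ) ≠ 0 := by exact_mod_cast (show n ≠ 0 by omega)
    have hnK0 : ((n - K : ℕ) : ℝ) ≠ 0 := by exact_mod_cast (show n - K ≠ 0 by omega)
    rw [ha_of_ge n (by omega), Real.log_mul hc.ne' hqpos.ne']
    field_simp
  have hlim : Tendsto (fun n : ℕ => a n ^ (1 / (n : ℝ))) atTop (𝓝 μ) := by
    have hexp := (Real.continuous_exp.tendsto _).comp hlog
    refine hexp.congr' ?_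
    filter_upwards [eventually_ge_atTop (M₁ + 1)] with n hn
    have hnK : 4 ≤ n - K := by omega
    have hqpos : 0 < q (n - K) := by
      show (0 : ℝ) < (triPolygonNumber (n - K) : ℝ); exact_mod_cast triPolygonNumber_pos hnK
    have hapos : 0 < a n := by rw [ha_of_ge n (by omega)]; exact mul_pos hc hqpos
    simp only [Function.comp]
    rw [Real.rpow_def_of_pos hapos, one_div, ← div_eq_mul_inv]
  -- apply the doubling lemma with `θ = 1/2`
  have hmain : ∀ N : ℕ, 1 ≤ N → a N ≤ (N : ℝ) ^ (-(1 / 2 : ℝ)) * μ ^ N :=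
    fun N hN => Madras1995_doubling_polynomial ha0 hsq hlim hN
  -- constants
  set B : ℝ := ∑ j ∈ range M₁, q j * j with hB
  have hB0 : 0 ≤ B := Finset.sum_nonneg fun j _ => mul_nonneg (hq0 j) (Nat.cast_nonneg _)
  refine ⟨μ ^ K / c + B, fun N hN => ?_⟩
  have hN0 : (0 : ℝ) < N := by exact_mod_cast (show 0 < N by omega)
  have hrpow : (N : ℝ) ^ (-(1 / 2 : ℝ)) = 1 / Real.sqrt N := by
    rw [Real.rpow_neg hN0.le, ← Real.sqrt_eq_rpow, one_div]
  have hsqrtN : 0 < Real.sqrt N := Real.sqrt_pos.2 hN0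
  have hN1 : (1 : ℝ) ≤ N := by exact_mod_cast hN
  have hsqrt_le : Real.sqrt (N : ℝ) ≤ N := by
    calc Real.sqrt (N : ℝ) ≤ Real.sqrt ((N : ℝ) ^ 2) := Real.sqrt_le_sqrt (by nlinarith)
      _ = N := Real.sqrt_sq hN0.le
  by_cases hbig : M₁ ≤ N + K
  · -- `c q_N = a (N+K) ≤ (N+K)^{-1/2} μ^{N+K} ≤ N^{-1/2} μ^K μ^N`
    have h1 := hmain (N + K) (by omega)
    rw [ha_of_ge (N + K) hbig, show N + K - K = N by omega] at h1
    have hNK0 : (0 : ℝ) < ((N + K : ℕ) : ℝ) := by exact_mod_cast (show 0 < N + K by omega)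
    have hmono : ((N + K : ℕ) : ℝ) ^ (-(1 / 2 : ℝ)) ≤ (N : ℝ) ^ (-(1 / 2 : ℝ)) := by
      rw [Real.rpow_neg hNK0.le, Real.rpow_neg hN0.le, ← Real.sqrt_eq_rpow, ← Real.sqrt_eq_rpow]
      exact inv_anti₀ hsqrtN (Real.sqrt_le_sqrt (by exact_mod_cast (show N ≤ N + K by omega)))
    have h2 : c * q N ≤ (N : ℝ) ^ (-(1 / 2 : ℝ)) * (μ ^ K * μ ^ N) := by
      calc c * q N ≤ ((N + K : ℕ) : ℝ) ^ (-(1 / 2 : ℝ)) * μ ^ (N + K) := h1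
        _ ≤ (N : ℝ) ^ (-(1 / 2 : ℝ)) * μ ^ (N + K) := mul_le_mul_of_nonneg_right hmono (by positivity)
        _ = (N : ℝ) ^ (-(1 / 2 : ℝ)) * (μ ^ K * μ ^ N) := by rw [pow_add]; ring
    have h3 : q N ≤ μ ^ K / c * (N : ℝ) ^ (-(1 / 2 : ℝ)) * μ ^ N := by
      rw [div_mul_eq_mul_div, div_mul_eq_mul_div, le_div_iff₀ hc]
      calc q N * c = c * q N := mul_comm _ _
        _ ≤ (N : ℝ) ^ (-(1 / 2 : ℝ)) * (μ ^ K * μ ^ N) := h2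
        _ = μ ^ K * (N : ℝ) ^ (-(1 / 2 : ℝ)) * μ ^ N := by ring
    calc q N ≤ μ ^ K / c * (N : ℝ) ^ (-(1 / 2 : ℝ)) * μ ^ N := h3
      _ ≤ (μ ^ K / c + B) * (N : ℝ) ^ (-(1 / 2 : ℝ)) * μ ^ N := by
          have : 0 ≤ (N : ℝ) ^ (-(1 / 2 : ℝ)) * μ ^ N := by positivity
          nlinarith
  · -- small `N`: `q_N ≤ q_N · N ≤ B`, and `1 ≤ √N⁻¹ · N^{...}`: use `q_N ≤ B · N^{-1/2} μ^N` via `q_N N · (1/√N) ≥ q_N`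
    have hNlt : N < M₁ := by omega
    have hqB : q N * N ≤ B := by
      rw [hB]
      exact Finset.single_le_sum (f := fun j => q j * (j : ℝ)) (fun j _ => mul_nonneg (hq0 j) (Nat.cast_nonneg _))
        (Finset.mem_range.2 hNlt)
    have hstep : q N ≤ B * (N : ℝ) ^ (-(1 / 2 : ℝ)) * μ ^ N := by
      rw [hrpow]
      have hμN : 1 ≤ μ ^ N := one_le_pow₀ hμ1
      calc q N = q N * N * (1 / (N : ℝ)) * 1 := by field_simp
        _ ≤ q N * N * (1 / Real.sqrt N) * μ ^ N := by
            apply mul_le_mul _ hμN zero_le_one (by positivity)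
            apply mul_le_mul_of_nonneg_left _ (mul_nonneg (hq0 N) hN0.le)
            exact one_div_le_one_div_of_le hsqrtN hsqrt_le
        _ ≤ B * (1 / Real.sqrt N) * μ ^ N := by
            apply mul_le_mul_of_nonneg_right _ (by positivity)
            exact mul_le_mul_of_nonneg_right hqB (by positivity)
    calc q N ≤ B * (N : ℝ) ^ (-(1 / 2 : ℝ)) * μ ^ N := hstep
      _ ≤ (μ ^ K / c + B) * (N : ℝ) ^ (-(1 / 2 : ℝ)) * μ ^ N := by
          have : 0 ≤ (N : ℝ) ^ (-(1 / 2 : ℝ)) * μ ^ N := by positivity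
          have : 0 ≤ μ ^ K / c := by positivity
          nlinarith

end Literature.Probability.RandomPlanarGeometry.SAW

end
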